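import Summits.Schanuel.Schanuel.Theorems.ZilberEacRamifiedTrichotomy
import Summits.Schanuel.Schanuel.Theorems.ZilberEacParamFibreCurveExamples
import HarnessLib

/-!
# Polynomially parametrised base curves, LXXVI: density from a transcendental RAMIFIED WITNESS over
# a polynomial curve — the growth / resonance / Kronecker trichotomy

HONEST FRAMING.  Cell `pub-schanuel` (Zilber's Exponential-Algebraic Closedness, case ladder;
host summit Schanuel), seat 2, gen 27.  The analogue over a polynomially parametrised base curve
`(x₀, x₁) = (g₀(t), g₁(t))` (`deg g₀ ≥ 1`) of file LX (graphs).  Input: the ramified witness of file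
LXXV — exponential points `q_j = (g₀(t_j), g₁(t_j), e^{g₀(t_j)}, e^{g₁(t_j)})` of the fibre-curve
surface `S = {(g₀(t), g₁(t), y₀, y₁) : P(t, y₀) = 0}` with `‖g₀(t_j)‖ → ∞`, the polar form
`g₀(t_j) = U₀(μ_j)μ_j^{-K}` (`μ_j → 0`) and the exact splitting `g₁(t_j) = Π(m₀ + j) + r(μ_j)`
(`Π ∈ ℂ[X]`, `r` analytic at `0`).  **`unprojectedDense_of_ramified_witness_param`**: if no nonzero
`H ∈ ℂ[s][t]` has `H(U₀(μ)μ^{-K}, e^{r(μ)}) = 0` for all small `μ ≠ 0`, then `I(S ∩ Γ_exp) = I(S)`.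
Proof = gen 23's trichotomy for the POLYNOMIAL phases `Π(m₀ + j)`: (a) some positive order of
`Re Π` survives ⟹ `|Re x₁| / log ‖x₁‖ → ∞` ⟹ THEOREM G (`unprojectedDense_of_growth`); (b) the
unit phases `e^{i Im Π(j)}` are periodic ⟹ constant on a residue class ⟹ THEOREM T in ramified form
(file LIX) in the coordinates `(x₀, y₁)`; (c) otherwise they avoid every finite set infinitely often
(Kronecker, file `ZilberEacPolynomialPhases`), contradicting the accumulation forced by a relation
`H(x₀, y₁) = 0` (THEOREM H + `phases_near_finset_of_relation`).  Complete classes of instances of an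
OPEN question (Mantova–Masser, PLMS 2024 §1 p. 5); EC(3,2) OPEN; NOT Schanuel's conjecture (neither
used nor implied); EAC ⇏ SC.
-/

noncomputable section

open Filter Topology Set Complex MvPolynomial
open Literature.NumberTheory.Transcendental Literature.ModelTheory.Zilber
open Literature.ModelTheory.ExponentialFields

set_option linter.dupNamespace false

namespace Summit.Schanuel.Schanuel.Theorems

/-- `log(2 + a + R) ≤ (D + log(1 + R)) · L` whenever `log(2 + a) ≤ D · L`, `1 ≤ L`, `a, R ≥ 0`.
[folklore] -/
theorem log_two_add_add_le {a R D L : ℝ} (ha : 0 ≤ a) (hR : 0 ≤ R) (hL : 1 ≤ L)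
    (h : Real.log (2 + a) ≤ D * L) : Real.log (2 + a + R) ≤ (D + Real.log (1 + R)) * L := by
  have h1 : 2 + a + R ≤ (2 + a) * (1 + R) := by nlinarith
  have h2 : Real.log (2 + a + R) ≤ Real.log (2 + a) + Real.log (1 + R) := by
    rw [← Real.log_mul (by positivity) (by positivity)]
    exact Real.log_le_log (by positivity) h1
  have h3 : 0 ≤ Real.log (1 + R) := Real.log_nonneg (by linarith)
  nlinarith

/-- **Density from a transcendental ramified witness over a polynomial curve** (growth / resonance /
Kronecker trichotomy).  See the module docstring.
[cite: MantovaMasser2023, §1 Further remarks, p. 5 (the question, open in general)]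
(new in this form) -/
theorem unprojectedDense_of_ramified_witness_param (g₀ g₁ : Polynomial ℂ) (hg₀ : 1 ≤ g₀.natDegree)
    (Q : Polynomial (Polynomial ℂ)) {P : MvPolynomial (Fin 2) ℂ}
    (hP : ∀ x y : ℂ, MvPolynomial.eval ![x, y] P = (Q.map (Polynomial.evalRingHom x)).eval y)
    (hirr : Irreducible P) (Pl : Polynomial ℂ)
    {U₀ r : ℂ → ℂ} (hU : AnalyticAt ℂ U₀ 0) (hr : AnalyticAt ℂ r 0) {K : ℕ}
    (htr : ∀ H : Polynomial (Polynomial ℂ), H ≠ 0 →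
      ¬ (∀ᶠ u in 𝓝[≠] (0 : ℂ),
        (H.map (Polynomial.evalRingHom (U₀ u * u⁻¹ ^ K))).eval (Complex.exp (r u)) = 0))
    (m₀ : ℕ) {μ t : ℕ → ℂ} (hμ0 : ∀ j, μ j ≠ 0) (hμ : Tendsto μ atTop (𝓝 0))
    (hx : ∀ j, g₀.eval (t j) = U₀ (μ j) * (μ j)⁻¹ ^ K)
    (hteq : ∀ j, (Q.map (Polynomial.evalRingHom (t j))).eval (Complex.exp (g₀.eval (t j))) = 0)
    (hnorm : Tendsto (fun j => ‖g₀.eval (t j)‖) atTop atTop)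
    (hid₁ : ∀ j, g₁.eval (t j) = Pl.eval ((m₀ + j : ℕ) : ℂ) + r (μ j)) :
    UnprojectedDense {w : Fin 2 ⊕ Fin 2 → ℂ | ∃ t : ℂ, w (Sum.inl 0) = g₀.eval t ∧
      w (Sum.inl 1) = g₁.eval t ∧ MvPolynomial.eval ![t, w (Sum.inr 0)] P = 0} := by
  classical
  -- the phase polynomial `j ↦ Π(j)` and its real and imaginary parts
  obtain ⟨gR, gI, hgR, hexpPK⟩ := exists_re_im_polynomials Pl
  -- the witness `w = e^r`
  set w : ℂ → ℂ := fun u => Complex.exp (r u) with hw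
  have hwan : AnalyticAt ℂ w 0 := hr.cexp
  have hw0 : ∀ u, w u ≠ 0 := fun u => Complex.exp_ne_zero _
  have hcast : ∀ j, ((m₀ + j : ℕ) : ℂ) = (((m₀ + j : ℕ) : ℝ) : ℂ) := fun j => by
    rw [Complex.ofReal_natCast]
  -- the exact identity with labels `m₀ + j`, through the real polynomials
  have hid : ∀ j, Complex.exp (g₁.eval (t j)) =
      urot (gI.eval ((m₀ + j : ℕ) : ℝ)) *
        ((Real.exp (gR.eval ((m₀ + j : ℕ) : ℝ)) : ℂ) * w (μ j)) := by
    intro j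
    rw [hid₁ j, Complex.exp_add, hcast, hexpPK]
    ring
  -- the surface and the sequence of exponential points
  have hirr3 := irreducible_rename_castSucc₂ hirr
  have hS := isIrreducibleClosed_paramSurface₃ g₀ g₁ hg₀ hirr3
  have hdim := zariskiDim_paramSurface₃ g₀ g₁ hg₀ hirr3
  rw [paramFibreCurveSurface_eq]
  set S := {w : Fin 2 ⊕ Fin 2 → ℂ | ∃ t : ℂ, w (Sum.inl 0) = g₀.eval t ∧ w (Sum.inl 1) = g₁.eval t ∧
      MvPolynomial.eval (Fin.cases t (fun i => w (Sum.inr i)) : Fin 3 → ℂ)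
        (rename (Fin.castSucc : Fin 2 → Fin 3) P) = 0} with hSdef
  set q : ℕ → Fin 2 ⊕ Fin 2 → ℂ := fun m =>
    Sum.elim ![g₀.eval (t m), g₁.eval (t m)]
      ![Complex.exp (g₀.eval (t m)), Complex.exp (g₁.eval (t m))] with hq
  have hqS : ∀ m, q m ∈ S := by
    intro m
    refine ⟨t m, by simp [hq], by simp [hq], ?_⟩
    rw [eval_cases_rename_castSucc]
    have ev : (![t m, (fun i => q m (Sum.inr i)) 0] : Fin 2 → ℂ) =
        ![t m, Complex.exp (g₀.eval (t m))] := by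
      simp [hq]
    rw [ev, hP]
    exact hteq m
  have hqΓ : ∀ m, q m ∈ expGraph ℂ 2 := by
    intro m
    rw [mem_expGraph_iff]
    intro i
    rw [Literature.ModelTheory.ExponentialFields.ExponentialRing.complex_exp_eq]
    fin_cases i <;> simp [hq]
  have hwlim : Tendsto (fun m => w (μ m)) atTop (𝓝 (w 0)) := hwan.continuousAt.tendsto.comp hμ
  have hrlim : Tendsto (fun m => r (μ m)) atTop (𝓝 (r 0)) := hr.continuousAt.tendsto.comp hμ
  by_cases hgRdeg : 1 ≤ gR.natDegree
  · /- (a) GROWTH: some order of `Re g₁(t_j)` survives; THEOREM G -/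
    have hre : ∀ m, (g₁.eval (t m)).re = gR.eval ((m₀ + m : ℕ) : ℝ) + (r (μ m)).re := by
      intro m
      rw [hid₁ m, Complex.add_re, hcast, hgR]
    obtain ⟨M, hM⟩ : ∃ M : ℝ, ∀ m, ‖r (μ m)‖ ≤ M := by
      obtain ⟨C, hC⟩ := isBounded_iff_forall_norm_le.1 (Metric.isBounded_range_of_tendsto _ hrlim)
      exact ⟨C, fun m => hC _ ⟨m, rfl⟩⟩
    have hM0 : 0 ≤ M := (norm_nonneg _).trans (hM 0)
    have ha : ∀ m, |(g₁.eval (t m)).re - gR.eval ((m₀ + m : ℕ) : ℝ)| ≤ M := by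
      intro m
      rw [hre m, add_sub_cancel_left]
      exact (Complex.abs_re_le_norm _).trans (hM m)
    -- the denominator: `‖g₁(t_j)‖ ≤ ‖Π(m₀ + j)‖ + M`
    obtain ⟨D, hD, hLD⟩ := log_two_add_norm_eval_le_log_label Pl (le_refl (0 : ℝ))
    have hLD' : ∀ m, Real.log (2 + ‖g₁.eval (t m)‖) ≤
        (D + Real.log (1 + M)) * Real.log (3 + 3 * ((m₀ + m : ℕ) : ℝ)) := by
      intro m
      have hlab0 : (0 : ℝ) ≤ ((m₀ + m : ℕ) : ℝ) := Nat.cast_nonneg _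
      have h1 : Real.log (2 + ‖Pl.eval ((m₀ + m : ℕ) : ℂ)‖) ≤
          D * Real.log (3 + 3 * ((m₀ + m : ℕ) : ℝ)) := by
        refine hLD _ _ hlab0 ?_
        rw [Complex.norm_natCast, zero_add]
        linarith
      have h2 : ‖g₁.eval (t m)‖ ≤ ‖Pl.eval ((m₀ + m : ℕ) : ℂ)‖ + M := by
        rw [hid₁ m]
        exact (norm_add_le _ _).trans (by linarith [hM m])
      calc Real.log (2 + ‖g₁.eval (t m)‖)
          ≤ Real.log (2 + ‖Pl.eval ((m₀ + m : ℕ) : ℂ)‖ + M) :=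
            Real.log_le_log (by positivity) (by linarith)
        _ ≤ (D + Real.log (1 + M)) * Real.log (3 + 3 * ((m₀ + m : ℕ) : ℝ)) :=
            log_two_add_add_le (norm_nonneg _) hM0 (one_le_log_three_add _ hlab0) h1
    have hD' : 0 < D + Real.log (1 + M) := by
      have := Real.log_nonneg (by linarith : (1 : ℝ) ≤ 1 + M)
      linarith
    have hgr : Tendsto (fun m => |(g₁.eval (t m)).re| / Real.log (2 + ‖g₁.eval (t m)‖)) atTop atTop :=
      tendsto_abs_div_log_of_linear_growth hgRdeg m₀ hD' ha
        (fun m => Real.log_le_log two_pos (by linarith [norm_nonneg (g₁.eval (t m))])) hLD'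
    refine unprojectedDense_of_growth hS (le_of_eq hdim) 1 hqS hqΓ ?_
    refine hgr.congr fun m => ?_
    simp [hq]
  · /- `g_R` is constant: the modulus of the phase factor is constant -/
    have hgR0 : gR.natDegree = 0 := by omega
    set r₀ : ℝ := gR.coeff 0 with hr₀
    have hgRev : ∀ x : ℝ, gR.eval x = r₀ := fun x => by
      rw [Polynomial.eq_C_of_natDegree_eq_zero hgR0, Polynomial.eval_C]
    set c₀ : ℂ := ((Real.exp r₀ : ℝ) : ℂ) with hc₀
    have hc₀0 : c₀ ≠ 0 := by rw [hc₀]; exact_mod_cast (Real.exp_pos r₀).ne'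
    have hid' : ∀ m, Complex.exp (g₁.eval (t m)) =
        urot (gI.eval ((m₀ + m : ℕ) : ℝ)) * (c₀ * w (μ m)) := by
      intro m; rw [hid m, hgRev]
    rcases urot_eval_periodic_or_not_near_finset gI with ⟨Dp, hDp, hper⟩ | hfar
    · /- (b) RESONANCE: periodic phases; constant phase on a subsequence; THEOREM T (file LIX) -/
      set phase : ℕ → ℂ := fun k => urot (gI.eval (k : ℝ)) with hphase
      have hperiodic : Function.Periodic phase Dp := fun k => hper k
      set g : ℕ → Fin Dp := fun m => ⟨(m₀ + m) % Dp, Nat.mod_lt _ hDp⟩ with hg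
      obtain ⟨i₀, hi₀⟩ := Finite.exists_infinite_fiber g
      have hSinf : Set.Infinite (g ⁻¹' {i₀}) := Set.infinite_coe_iff.1 hi₀
      set ζ : ℂ := phase (i₀ : ℕ) * c₀ with hζ
      have hζ0 : ζ ≠ 0 := mul_ne_zero (by rw [hphase]; exact (norm_pos_iff.1 (by rw [norm_urot]; norm_num)))
        hc₀0
      have hphase_eq : ∀ m, g m = i₀ → phase (m₀ + m) = phase (i₀ : ℕ) := by
        intro m hm
        have h1 : ((i₀ : ℕ)) = (m₀ + m) % Dp := by rw [← hm]
        rw [h1]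
        exact (hperiodic.map_mod_nat (m₀ + m)).symm
      -- the subsequence of constant phase
      set φ : ℕ → ℕ := Nat.nth (· ∈ g ⁻¹' {i₀}) with hφ
      have hφS : ∀ j, g (φ j) = i₀ := fun j => Nat.nth_mem_of_infinite (p := (· ∈ g ⁻¹' {i₀})) hSinf j
      have hφtop : Tendsto φ atTop atTop :=
        (Nat.nth_strictMono (p := (· ∈ g ⁻¹' {i₀})) hSinf).tendsto_atTop
      have hqnorm : Tendsto (fun j => ‖q (φ j) (Sum.inl 0)‖) atTop atTop := by
        refine (hnorm.comp hφtop).congr fun j => ?_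
        simp [hq]
      have hw' : AnalyticAt ℂ (fun u => ζ * w u) 0 := analyticAt_const.mul hwan
      have hx' : ∀ j, q (φ j) (Sum.inl 0) = U₀ (μ (φ j)) * (μ (φ j))⁻¹ ^ K := fun j => by
        simp only [hq, Sum.elim_inl, Matrix.cons_val_zero]
        exact hx (φ j)
      have hrel : ∀ j, q (φ j) (Sum.inr 1) = (fun u => ζ * w u) (μ (φ j)) := by
        intro j
        simp only [hq, Sum.elim_inr, Matrix.cons_val_one, Matrix.cons_val_zero]
        rw [hid' (φ j), hζ]
        have := hphase_eq (φ j) (hφS j)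
        simp only [hphase, Nat.cast_add] at this
        push_cast
        rw [this]
        ring
      have htr' : ∀ H : Polynomial (Polynomial ℂ), H ≠ 0 →
          ¬ (∀ᶠ u in 𝓝[≠] (0 : ℂ),
            (H.map (Polynomial.evalRingHom (U₀ u * u⁻¹ ^ K))).eval (w u) = 0) := htr
      exact unprojectedDense_of_transcendental_relation_pole hS (le_of_eq hdim) 0 1 (fun j => hqS (φ j))
        (fun j => hqΓ (φ j)) hqnorm hU hw' K (fun j => hμ0 (φ j)) (hμ.comp hφtop) hx' hrel
        (transcendental_pole_const_mul hζ0 htr')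
    · /- (c) NON-RESONANCE: a relation on all large labels would make the phases accumulate -/
      by_contra hnot
      have hex : ∃ f, f ∈ vanishingIdeal ℂ (S ∩ expGraph ℂ 2) ∧ f ∉ vanishingIdeal ℂ S := by
        by_contra h
        push Not at h
        exact hnot (le_antisymm h (vanishingIdeal_anti_mono Set.inter_subset_left))
      obtain ⟨f, hfΓ, hfS⟩ := hex
      -- THEOREM H: one relation on all points
      obtain ⟨H, hH0, hH⟩ := exists_polyPoly_relation_of_forall_aeval_eq_zero hS (le_of_eq hdim) hqS hfS
        (fun m => (mem_vanishingIdeal_iff.1 hfΓ) _ ⟨hqS m, hqΓ m⟩) (Sum.inl 0) (Sum.inr 1)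
      set e : ℕ → ℂ := fun m => urot (gI.eval ((m₀ + m : ℕ) : ℝ)) with he
      have he1 : ∀ m, ‖e m‖ = 1 := fun m => norm_urot _
      have hrel : ∀ m, (H.map (Polynomial.evalRingHom (g₀.eval (t m)))).eval (e m * (c₀ * w (μ m))) = 0 := by
        intro m
        have h1 := hH m
        simp only [hq, Sum.elim_inl, Sum.elim_inr, Matrix.cons_val_zero, Matrix.cons_val_one] at h1
        rwa [hid' m] at h1
      -- the phases accumulate at a finite set …
      have hwlim' : Tendsto (fun m => c₀ * w (μ m)) atTop (𝓝 (c₀ * w 0)) := hwlim.const_mul c₀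
      obtain ⟨F, hF⟩ := phases_near_finset_of_relation hH0 hnorm he1 (mul_ne_zero hc₀0 (hw0 0)) hwlim' hrel
      -- … but the non-resonant phase sequence does not
      obtain ⟨ε, hε, hfar'⟩ := hfar F
      obtain ⟨m₁, hm₁⟩ := Filter.eventually_atTop.1 (hF ε hε)
      obtain ⟨k', hk', hkfar⟩ := hfar' (m₀ + m₁)
      obtain ⟨ζ, hζF, hζ⟩ := hm₁ (k' - m₀) (by omega)
      have hkk : m₀ + (k' - m₀) = k' := by omega
      rw [he] at hζ
      simp only [hkk] at hζ
      exact absurd hζ (not_lt.2 (hkfar ζ hζF))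

end Summit.Schanuel.Schanuel.Theorems
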